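import Summits.QuantumFields.QCD.Theses.PauliWegnerSea
import Literature.MathematicalPhysics.QuantumLattice.OverlapLocality
import Literature.MathematicalPhysics.QuantumLattice.GaugeGroups
import Literature.LinearAlgebra.Matrix.MvPolynomialDetDegree

/-!
# Stub `stub_polyModel` of crux `FibreCofactorDomination` (stmt-QuantumFields-11510)

Line `Sketch-ideator3` (card A `random-refit-second-moment`), route PauliWegnerSea (sub QCD).

**Band limit of the adjugate block in the star links.**  For an enumeration `ι : Fin k ↪ Edge`
covering the star links of `x, y`, every adjugate entry of the `r = 1` Wilson–Dirac matrix of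
the refitted configuration `refit W` (star links from `W`, the rest from the background `U`) is
the evaluation of ONE polynomial `P` (depending on `m₀, L, U, x, y, ι` and the entry, not on
`W`) of total degree `≤ 216` at the coordinates "entries of `W (ι s)` and of `(W (ι s))⁻¹`".

Proof: copy the definition of `wilsonDirac` into a matrix `M̂` over
`MvPolynomial (Fin k × Fin 3 × Fin 3 × Bool) ℂ`, replacing the forward link entry of a star
edge by the variable `X (s, a, b, false)` and the backward (inverse) entry by `X (s, a, b, true)`
(`s` the `ι`-slot of the edge) and every other scalar by a constant.  Evaluation at the
coordinates of `W` returns `D_W(refit W)` entrywise, hence (`eval_adjugate_apply`) the adjugate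
entry.  Degrees: every entry of `M̂` has total degree `≤ 1`, and an entry in a column whose site
is not one of the `≤ 18` sites `{x, y} ∪ {x ± μ̂, y ± μ̂}` contains no star edge, hence has
degree `0`; the Leibniz bound `totalDegree_adjugate_le` gives `≤ 12 · 18 = 216`.
-/

noncomputable section

namespace Summit.QuantumFields.QCD.Theorems.RandomRefit

open scoped BigOperators Matrix
open MeasureTheory Filter Literature.MathematicalPhysics.QuantumFieldTheory
  Literature.MathematicalPhysics.QuantumLattice Literature.Probability.LatticeModels

local notation "SU3" => Matrix.specialUnitaryGroup (Fin 3) ℂ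

/-- Degree of a guarded product `if c then C f * l else 0` is at most that of `l`. -/
theorem totalDegree_ite_C_mul_le {σ : Type*} (c : Prop) [Decidable c] (f : ℂ)
    (l : MvPolynomial σ ℂ) :
    (if c then MvPolynomial.C f * l else 0).totalDegree ≤ l.totalDegree := by
  split_ifs
  · exact (MvPolynomial.totalDegree_mul _ _).trans (by rw [MvPolynomial.totalDegree_C, zero_add])
  · rw [MvPolynomial.totalDegree_zero]; exact Nat.zero_le _

/-- The `≤ 18` sites whose columns may carry star-link variables. -/
theorem card_varSites_le {L : ℕ} [NeZero L] (x y : TorusSite 4 L) :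
    (({x, y} : Finset (TorusSite 4 L)) ∪ (Finset.univ : Finset (Fin 4)).biUnion fun μ =>
        {Site.shift x μ, x - Pi.single μ 1, Site.shift y μ, y - Pi.single μ 1}).card ≤ 18 := by
  classical
  refine (Finset.card_union_le _ _).trans ?_
  have h1 : ({x, y} : Finset (TorusSite 4 L)).card ≤ 2 :=
    (Finset.card_insert_le _ _).trans (by simp)
  have h2 : ((Finset.univ : Finset (Fin 4)).biUnion fun μ =>
      ({Site.shift x μ, x - Pi.single μ 1, Site.shift y μ, y - Pi.single μ 1} :
        Finset (TorusSite 4 L))).card ≤ 16 := by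
    refine Finset.card_biUnion_le.trans ?_
    calc ∑ μ : Fin 4, ({Site.shift x μ, x - Pi.single μ 1, Site.shift y μ, y - Pi.single μ 1} :
          Finset (TorusSite 4 L)).card ≤ ∑ _μ : Fin 4, 4 := Finset.sum_le_sum fun μ _ => by
            refine (Finset.card_insert_le _ _).trans ?_
            refine Nat.succ_le_succ ((Finset.card_insert_le _ _).trans ?_)
            refine Nat.succ_le_succ ((Finset.card_insert_le _ _).trans ?_)
            simp
      _ = 16 := by simp
  omega

/-- **Band limit of the adjugate block** (registered stub `stub_polyModel` of crux
stmt-QuantumFields-11510, line Sketch-ideator3). -/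
theorem stub_polyModel : ∀ (m₀ : ℝ) (L : ℕ) [NeZero L]
    (U : GaugeConfig 4 L (Matrix.specialUnitaryGroup (Fin 3) ℂ)) (x y : TorusSite 4 L) (k : ℕ)
    (ι : Fin k ↪ Edge 4 L),
    (∀ e : Edge 4 L, (e.1 = x ∨ Site.shift e.1 e.2 = x ∨ e.1 = y ∨ Site.shift e.1 e.2 = y) →
      e ∈ Set.range ι) →
    ∀ (p q : TorusSite 4 L × Fin 3 × Fin 4),
    ∃ P : MvPolynomial (Fin k × Fin 3 × Fin 3 × Bool) ℂ, P.totalDegree ≤ 216 ∧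
      ∀ W : GaugeConfig 4 L (Matrix.specialUnitaryGroup (Fin 3) ℂ),
        MvPolynomial.eval
            (fun v : Fin k × Fin 3 × Fin 3 × Bool =>
              if v.2.2.2 then
                ((W (ι v.1))⁻¹ : Matrix.specialUnitaryGroup (Fin 3) ℂ).1 v.2.1 v.2.2.1
              else (W (ι v.1) : Matrix.specialUnitaryGroup (Fin 3) ℂ).1 v.2.1 v.2.2.1) P =
          (wilsonDirac (fundamentalRep (Fin 3))
              (fun e => if e.1 = x ∨ Site.shift e.1 e.2 = x ∨ e.1 = y ∨ Site.shift e.1 e.2 = y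
                then W e else U e) m₀ 1).adjugate p q := by
  intro m₀ L _ U x y k ι hι p q
  classical
  -- the slot of a star edge and its defining property
  have hslot : ∀ (e : Edge 4 L)
      (h : e.1 = x ∨ Site.shift e.1 e.2 = x ∨ e.1 = y ∨ Site.shift e.1 e.2 = y),
      ι ((Equiv.ofInjective ι ι.injective).symm ⟨e, hι e h⟩) = e := fun e h =>
    Equiv.apply_ofInjective_symm ι.injective ⟨e, hι e h⟩
  -- link entries as polynomials: variables on star edges, constants elsewhere
  set LV : Edge 4 L → Fin 3 → Fin 3 → Bool → MvPolynomial (Fin k × Fin 3 × Fin 3 × Bool) ℂ :=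
    fun e a b β =>
      if h : (e.1 = x ∨ Site.shift e.1 e.2 = x ∨ e.1 = y ∨ Site.shift e.1 e.2 = y) then
        MvPolynomial.X ((Equiv.ofInjective ι ι.injective).symm ⟨e, hι e h⟩, a, b, β)
      else MvPolynomial.C (if β then ((U e)⁻¹ : SU3).1 a b else (U e : SU3).1 a b) with hLV
  have hLVdeg : ∀ (e : Edge 4 L) (a b : Fin 3) (β : Bool), (LV e a b β).totalDegree ≤ 1 := by
    intro e a b β
    by_cases h : (e.1 = x ∨ Site.shift e.1 e.2 = x ∨ e.1 = y ∨ Site.shift e.1 e.2 = y)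
    · simp only [hLV, dif_pos h, MvPolynomial.totalDegree_X, le_refl]
    · simp only [hLV, dif_neg h, MvPolynomial.totalDegree_C]
      exact Nat.zero_le _
  have hLVdeg0 : ∀ (e : Edge 4 L) (a b : Fin 3) (β : Bool),
      ¬ (e.1 = x ∨ Site.shift e.1 e.2 = x ∨ e.1 = y ∨ Site.shift e.1 e.2 = y) →
        (LV e a b β).totalDegree = 0 := by
    intro e a b β h
    simp only [hLV, dif_neg h, MvPolynomial.totalDegree_C]
  -- the model matrix (the definition of `wilsonDirac` with `r = 1`, coefficients in `C`)
  set M : Matrix (TorusSite 4 L × Fin 3 × Fin 4) (TorusSite 4 L × Fin 3 × Fin 4)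
      (MvPolynomial (Fin k × Fin 3 × Fin 3 × Bool) ℂ) := Matrix.of fun p q =>
    MvPolynomial.C (if p = q then ((m₀ + 4 * 1 : ℝ) : ℂ) else 0) -
      MvPolynomial.C (1 / 2 : ℂ) * ∑ μ : Fin 4,
        ((if q.1 = Site.shift p.1 μ then
            MvPolynomial.C ((((1 : ℝ) : ℂ) • (1 : Matrix (Fin 4) (Fin 4) ℂ) - euclideanGamma μ)
              p.2.2 q.2.2) * LV (p.1, μ) p.2.1 q.2.1 false
          else 0) +
         (if p.1 = Site.shift q.1 μ then
            MvPolynomial.C ((((1 : ℝ) : ℂ) • (1 : Matrix (Fin 4) (Fin 4) ℂ) + euclideanGamma μ)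
              p.2.2 q.2.2) * LV (q.1, μ) p.2.1 q.2.1 true
          else 0)) with hM
  -- (1) every entry has total degree ≤ 1
  have hdeg1 : ∀ j c, (M j c).totalDegree ≤ 1 := by
    intro j c
    simp only [hM, Matrix.of_apply]
    refine (MvPolynomial.totalDegree_sub _ _).trans (max_le ?_ ?_)
    · rw [MvPolynomial.totalDegree_C]; exact Nat.zero_le _
    refine (MvPolynomial.totalDegree_mul _ _).trans ?_
    rw [MvPolynomial.totalDegree_C, zero_add]
    refine (MvPolynomial.totalDegree_finsetSum _ _).trans (Finset.sup_le fun μ _ => ?_)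
    refine (MvPolynomial.totalDegree_add _ _).trans (max_le ?_ ?_)
    · exact (totalDegree_ite_C_mul_le _ _ _).trans (hLVdeg _ _ _ _)
    · exact (totalDegree_ite_C_mul_le _ _ _).trans (hLVdeg _ _ _ _)
  -- (2) columns at sites outside V carry no variable
  set V : Finset (TorusSite 4 L) := ({x, y} : Finset (TorusSite 4 L)) ∪
    (Finset.univ : Finset (Fin 4)).biUnion fun μ =>
      {Site.shift x μ, x - Pi.single μ 1, Site.shift y μ, y - Pi.single μ 1} with hV
  have hxV : x ∈ V := Finset.mem_union_left _ (by simp)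
  have hyV : y ∈ V := Finset.mem_union_left _ (by simp)
  have hsxV : ∀ μ : Fin 4, Site.shift x μ ∈ V := fun μ =>
    Finset.mem_union_right _ (Finset.mem_biUnion.2 ⟨μ, Finset.mem_univ _, by simp⟩)
  have hsyV : ∀ μ : Fin 4, Site.shift y μ ∈ V := fun μ =>
    Finset.mem_union_right _ (Finset.mem_biUnion.2 ⟨μ, Finset.mem_univ _, by simp⟩)
  have hmxV : ∀ μ : Fin 4, x - Pi.single μ 1 ∈ V := fun μ =>
    Finset.mem_union_right _ (Finset.mem_biUnion.2 ⟨μ, Finset.mem_univ _, by simp⟩)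
  have hmyV : ∀ μ : Fin 4, y - Pi.single μ 1 ∈ V := fun μ =>
    Finset.mem_union_right _ (Finset.mem_biUnion.2 ⟨μ, Finset.mem_univ _, by simp⟩)
  have hdeg0 : ∀ j c, c.1 ∉ V → (M j c).totalDegree = 0 := by
    intro j c hc
    apply Nat.eq_zero_of_le_zero
    simp only [hM, Matrix.of_apply]
    refine (MvPolynomial.totalDegree_sub _ _).trans (max_le ?_ ?_)
    · rw [MvPolynomial.totalDegree_C]
    refine (MvPolynomial.totalDegree_mul _ _).trans ?_
    rw [MvPolynomial.totalDegree_C, zero_add]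
    refine (MvPolynomial.totalDegree_finsetSum _ _).trans (Finset.sup_le fun μ _ => ?_)
    refine (MvPolynomial.totalDegree_add _ _).trans (max_le ?_ ?_)
    · split_ifs with hcond
      · refine (MvPolynomial.totalDegree_mul _ _).trans ?_
        rw [MvPolynomial.totalDegree_C, zero_add, hLVdeg0]
        rintro (h | h | h | h)
        · exact hc (by rw [hcond]; exact h ▸ hsxV μ)
        · exact hc (by rw [hcond, h]; exact hxV)
        · exact hc (by rw [hcond]; exact h ▸ hsyV μ)
        · exact hc (by rw [hcond, h]; exact hyV)
      · rw [MvPolynomial.totalDegree_zero]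
    · split_ifs with hcond
      · refine (MvPolynomial.totalDegree_mul _ _).trans ?_
        rw [MvPolynomial.totalDegree_C, zero_add, hLVdeg0]
        rintro (h | h | h | h)
        · exact hc (h ▸ hxV)
        · exact hc (((eq_shift_iff x c.1 μ).1 h.symm) ▸ hmxV μ)
        · exact hc (h ▸ hyV)
        · exact hc (((eq_shift_iff y c.1 μ).1 h.symm) ▸ hmyV μ)
      · rw [MvPolynomial.totalDegree_zero]
  -- (3) the Leibniz bound
  refine ⟨M.adjugate p q, ?_, ?_⟩
  · have hMd : ∀ j c, (M j c).totalDegree ≤ (if c.1 ∈ V then 1 else 0) := by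
      intro j c
      by_cases hc : c.1 ∈ V
      · rw [if_pos hc]; exact hdeg1 j c
      · rw [if_neg hc, hdeg0 j c hc]
    refine (Literature.LinearAlgebra.Matrix.totalDegree_adjugate_le M _ hMd p q).trans ?_
    rw [Finset.sum_boole]
    have hfilter : (Finset.univ.filter fun c : TorusSite 4 L × Fin 3 × Fin 4 => c.1 ∈ V) =
        V ×ˢ (Finset.univ : Finset (Fin 3 × Fin 4)) := by
      ext c; simp
    rw [hfilter, Finset.card_product]
    have hV18 := card_varSites_le x y
    rw [← hV] at hV18
    simp only [Finset.card_univ, Fintype.card_prod, Fintype.card_fin, Nat.cast_id]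
    omega
  -- (4) evaluation at the coordinates of `W`
  · intro W
    have hLVeval : ∀ (e : Edge 4 L) (a b : Fin 3) (β : Bool),
        MvPolynomial.eval
            (fun v : Fin k × Fin 3 × Fin 3 × Bool =>
              if v.2.2.2 then ((W (ι v.1))⁻¹ : SU3).1 v.2.1 v.2.2.1
              else (W (ι v.1) : SU3).1 v.2.1 v.2.2.1) (LV e a b β) =
          if β then
            ((if e.1 = x ∨ Site.shift e.1 e.2 = x ∨ e.1 = y ∨ Site.shift e.1 e.2 = y
              then W e else U e)⁻¹ : SU3).1 a b
          else ((if e.1 = x ∨ Site.shift e.1 e.2 = x ∨ e.1 = y ∨ Site.shift e.1 e.2 = y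
              then W e else U e) : SU3).1 a b := by
      intro e a b β
      by_cases h : (e.1 = x ∨ Site.shift e.1 e.2 = x ∨ e.1 = y ∨ Site.shift e.1 e.2 = y)
      · cases β <;> simp [hLV, h, hslot]
      · cases β <;> simp [hLV, h]
    rw [Literature.LinearAlgebra.Matrix.eval_adjugate_apply]
    congr 1
    ext p' q'
    rw [Matrix.map_apply, hM, Matrix.of_apply, wilsonDirac, Matrix.of_apply]
    simp only [map_sub, map_mul, map_sum, map_add, MvPolynomial.eval_C, fundamentalRep_apply]
    congr 1
    congr 1
    refine Finset.sum_congr rfl fun μ _ => ?_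
    congr 1
    · by_cases hc : q'.1 = Site.shift p'.1 μ
      · simp only [if_pos hc, map_mul, MvPolynomial.eval_C, hLVeval, Bool.false_eq_true,
          ↓reduceIte]
      · simp only [if_neg hc, map_zero]
    · by_cases hc : p'.1 = Site.shift q'.1 μ
      · simp only [if_pos hc, map_mul, MvPolynomial.eval_C, hLVeval, ↓reduceIte]
      · simp only [if_neg hc, map_zero]

end Summit.QuantumFields.QCD.Theorems.RandomRefit

end
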